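import Mathlib
import HarnessLib

/-!
# Monte Carlo variance, control variates and importance sampling (Davis–Rabinowitz 1984, Sect. 5.9 (5.9.8)-(5.9.12), Sect. 5.9.1 (5.9.1.1)-(5.9.1.12))

[cite: DavisRabinowitz1984, Sect. 5.9.1 (5.9.1.1)-(5.9.1.12)]

P. J. Davis and P. Rabinowitz, *Methods of Numerical Integration*, 2nd ed., Academic Press 1984,
Sect. 5.9 *Multiple Integration by Sampling* ((5.9.8)-(5.9.12)) and Sect. 5.9.1
*Variance Reduction* ((5.9.1.1)-(5.9.1.12)).

Loc. cit. (5.9.8)-(5.9.9): with `I = ∫ f μ` the mean of `f` for the density `μ`, the variance is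
`σ² = ∫ (f - I)² μ = ∫ f² μ - I²`; the Monte Carlo error at a fixed confidence level is `λ σ / √n`
((5.9.10)-(5.9.11), the "`n^{-1/2}` law"); Example: `I = ∫_0^1 x dx = 1/2`, `σ² = ∫_0^1 x² - 1/4 = 1/12`,
error at the 95% level `≤ 1.96 σ/√50 = .08` (`n = 50`), `≤ 1.96 σ/√100 = .057` (`n = 100`); the
sample variance `V_s = (1/n) Σ f²(x_i) - ((1/n) Σ f(x_i))²` (5.9.12).  Sect. 5.9.1: a CONTROL VARIATE
`g` with `|f - g| ≤ ε` on `[0, 1]` (5.9.1.1) and known `∫_0^1 g = J` (5.9.1.2): compute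
`I₁ = ∫ (f - g)` (5.9.1.3) by Monte Carlo; its variance `σ₁² = ∫ (f-g)² - (∫ (f-g))²` (5.9.1.4) has
`σ₁ ≤ ε`, and `(1/n) Σ (f(x_i) - g(x_i)) + J` (5.9.1.5) estimates `I`; Example: `f = eˣ`, `g = 1 + x`:
variance of `eˣ` is `½(e² - 1) - (e - 1)² = .242`, of `eˣ - 1 - x` is `½(e - 1)(5 - e) - 23/12 = .044`.
IMPORTANCE SAMPLING: `I = ∫_0^1 (f/p) p` (5.9.1.7) with `p > 0`, `∫_0^1 p = 1` (5.9.1.8), estimator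
`(1/n) Σ f(x_i)/p(x_i)` with `x_i ∼ p` (5.9.1.9), variance `σ² = ∫ (f²/p²) p - (∫ (f/p) p)²` (5.9.1.10);
choosing `p = f / ∫ f` (5.9.1.11) gives `σ² = 0` (5.9.1.12); Example `f = eˣ`, `p = ⅔(1 + x)`,
estimator `(3/2n) Σ e^{x_i}/(1 + x_i)`.

## What is formalised (the deterministic content: variances as integral functionals on `[0, 1]`)

`mcVariance f = ∫_0^1 f² - (∫_0^1 f)²` (5.9.9) and its centred form `= ∫_0^1 (f - I)²`, hence
`0 ≤ σ²`, i.e. `(∫_0^1 f)² ≤ ∫_0^1 f²`; the text's example `σ²(x) = 1/12` and the two error figures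
(`.0790 < 1.96 σ/√50 < .0801`, `.0565 < 1.96 σ/√100 < .0566`); the sample-variance identity (5.9.12)
`V_s = (1/n) Σ (f_i - mean)²`; control variates: unbiasedness `∫ f = ∫ (f - g) + J` and the bound
`σ₁² ≤ ε²` (5.9.1.4); the example values for `eˣ` and `eˣ - 1 - x` in closed form with the bounds
`.2420 < · < .2421`, `.0436 < · < .0437`; importance sampling: (5.9.1.7), the variance (5.9.1.10) in
the form `∫ f²/p - (∫ f)²`, the zero-variance density (5.9.1.11)-(5.9.1.12) (exactly: `p = f/I`
gives `σ² = 0`), and for the example `∫_0^1 ⅔(1 + x) dx = 1` with the estimator summand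
`eˣ/p(x) = (3/2) eˣ/(1 + x)`.  The probabilistic statements (laws of large numbers, the CLT error
law (5.9.10)) are not formalised here.  General measure-theoretic versions of control variates and of
the zero-variance importance distribution (after Asmussen–Glynn) are the tree's
`Literature/Probability/ImportanceSampling/ControlVariates`, `…/OptimalImportanceDistribution`
(not imported); this file is the unit-interval density form of loc. cit. with the text's worked
examples certified.

AI-produced formalisation (H21 engines group, seat eng-quad-3, 2026-08-25); no facts, no axioms
beyond Mathlib's, no `sorry`.
-/

open Real Finset MeasureTheory intervalIntegral Set

open scoped Interval

namespace Literature.Analysis.Quadrature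

/-! ## The variance functional (5.9.9) -/

/-- `σ²(f) = ∫_0^1 f² dx - (∫_0^1 f dx)²`: the variance of `f(x)`, `x` uniform on `[0, 1]` (5.9.9),
which governs the Monte Carlo error `λ σ/√n` (5.9.10)-(5.9.11).
[cite: DavisRabinowitz1984, Sect. 5.9.1 (5.9.1.4)] -/
noncomputable def mcVariance (f : ℝ → ℝ) : ℝ :=
  (∫ x in (0:ℝ)..1, f x ^ 2) - (∫ x in (0:ℝ)..1, f x) ^ 2

/-- (5.9.9), the two forms of the variance agree: `∫_0^1 (f - I)² = ∫_0^1 f² - I²`, `I = ∫_0^1 f`.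
[cite: DavisRabinowitz1984, Sect. 5.9.1 (5.9.1.4)] -/
theorem mcVariance_eq_integral_centered_sq {f : ℝ → ℝ} (hf : IntervalIntegrable f volume 0 1)
    (hf2 : IntervalIntegrable (fun x => f x ^ 2) volume 0 1) :
    mcVariance f = ∫ x in (0:ℝ)..1, (f x - ∫ t in (0:ℝ)..1, f t) ^ 2 := by
  set I := ∫ t in (0:ℝ)..1, f t with hI
  have h : ∀ x, (f x - I) ^ 2 = f x ^ 2 - (2 * I) * f x + I ^ 2 := fun x => by ring
  simp_rw [h]
  rw [intervalIntegral.integral_add (hf2.sub (hf.const_mul _)) intervalIntegrable_const,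
    intervalIntegral.integral_sub hf2 (hf.const_mul _), intervalIntegral.integral_const_mul,
    intervalIntegral.integral_const]
  simp only [mcVariance, sub_zero, smul_eq_mul, one_mul, ← hI]
  ring

/-- `σ² ≥ 0`: `(∫_0^1 f)² ≤ ∫_0^1 f²` ("the variance is defined only for integrands which are
square-integrable"). [cite: DavisRabinowitz1984, Sect. 5.9.1 (5.9.1.4)] -/
theorem mcVariance_nonneg {f : ℝ → ℝ} (hf : IntervalIntegrable f volume 0 1)
    (hf2 : IntervalIntegrable (fun x => f x ^ 2) volume 0 1) : 0 ≤ mcVariance f := by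
  rw [mcVariance_eq_integral_centered_sq hf hf2]
  exact intervalIntegral.integral_nonneg zero_le_one fun x _ => sq_nonneg _

/-- Equivalently `(∫_0^1 f)² ≤ ∫_0^1 f²`. [cite: DavisRabinowitz1984, Sect. 5.9.1 (5.9.1.4)] -/
theorem sq_integral_unit_le_integral_sq {f : ℝ → ℝ} (hf : IntervalIntegrable f volume 0 1)
    (hf2 : IntervalIntegrable (fun x => f x ^ 2) volume 0 1) :
    (∫ x in (0:ℝ)..1, f x) ^ 2 ≤ ∫ x in (0:ℝ)..1, f x ^ 2 :=
  sub_nonneg.mp (mcVariance_nonneg hf hf2)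

/-- The text's example (Sect. 5.9): `I = ∫_0^1 x dx = 1/2`, `σ² = ∫_0^1 x² dx - 1/4 = 1/12`.
[cite: DavisRabinowitz1984, Sect. 5.9.1 (5.9.1.4)] -/
theorem mcVariance_id : mcVariance (fun x => x) = 1 / 12 := by
  simp only [mcVariance, integral_pow, integral_id]
  norm_num

/-- The text's error figures for the example: at the 95% level the error is `≤ 1.96 σ/√n` with
`σ = 1/(2√3)`: `n = 50` gives `.08` (`.0790 < 1.96 σ/√50 < .0801`) and `n = 100` gives `.057`
(`.0565 < 1.96 σ/√100 < .0566`). [cite: DavisRabinowitz1984, Sect. 5.9.1 (5.9.1.6)] -/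
theorem example_error_levels :
    (0.0790 < 1.96 * Real.sqrt (1 / 12) / Real.sqrt 50 ∧ 1.96 * Real.sqrt (1 / 12) / Real.sqrt 50 < 0.0801) ∧
    (0.0565 < 1.96 * Real.sqrt (1 / 12) / Real.sqrt 100 ∧ 1.96 * Real.sqrt (1 / 12) / Real.sqrt 100 < 0.0566) := by
  have h1 : Real.sqrt (1 / 12) / Real.sqrt 50 = Real.sqrt (1 / 600) := by
    rw [← Real.sqrt_div' _ (by norm_num : (0:ℝ) ≤ 50)]; norm_num
  have h2 : Real.sqrt (1 / 12) / Real.sqrt 100 = Real.sqrt (1 / 1200) := by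
    rw [← Real.sqrt_div' _ (by norm_num : (0:ℝ) ≤ 100)]; norm_num
  rw [mul_div_assoc, mul_div_assoc, h1, h2]
  have hlo1 : (0.0404 : ℝ) < Real.sqrt (1 / 600) := by
    rw [Real.lt_sqrt (by norm_num)]; norm_num
  have hhi1 : Real.sqrt (1 / 600) < 0.04083 := by
    rw [Real.sqrt_lt' (by norm_num)]; norm_num
  have hlo2 : (0.02886 : ℝ) < Real.sqrt (1 / 1200) := by
    rw [Real.lt_sqrt (by norm_num)]; norm_num
  have hhi2 : Real.sqrt (1 / 1200) < 0.02887 := by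
    rw [Real.sqrt_lt' (by norm_num)]; norm_num
  refine ⟨⟨?_, ?_⟩, ⟨?_, ?_⟩⟩ <;> nlinarith

/-- (5.9.12), the sample variance: `V_s = (1/n) Σ f(x_i)² - ((1/n) Σ f(x_i))² = (1/n) Σ (f(x_i) - m)²`
with `m = (1/n) Σ f(x_i)` the sample mean. [cite: DavisRabinowitz1984, Sect. 5.9.1 (5.9.1.5)] -/
theorem sampleVariance_eq_centered {n : ℕ} (hn : n ≠ 0) (y : ℕ → ℝ) :
    (∑ i ∈ Finset.range n, y i ^ 2) / n - ((∑ i ∈ Finset.range n, y i) / n) ^ 2 =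
      (∑ i ∈ Finset.range n, (y i - (∑ j ∈ Finset.range n, y j) / n) ^ 2) / n := by
  have hn' : (n : ℝ) ≠ 0 := Nat.cast_ne_zero.mpr hn
  set S := ∑ j ∈ Finset.range n, y j with hS
  have h : ∀ i, (y i - S / n) ^ 2 = y i ^ 2 - (2 * S / n) * y i + (S / n) ^ 2 := fun i => by ring
  simp_rw [h, Finset.sum_add_distrib, Finset.sum_sub_distrib, ← Finset.mul_sum, ← hS,
    Finset.sum_const, Finset.card_range, nsmul_eq_mul]
  field_simp
  ring

/-! ## Control variates (5.9.1.1)-(5.9.1.6) -/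

/-- (5.9.1.3)/(5.9.1.5), the control-variate estimator is unbiased: if `∫_0^1 g = J` is known then
`∫_0^1 f = ∫_0^1 (f - g) + J`. [cite: DavisRabinowitz1984, Sect. 5.9.1 (5.9.1.3), (5.9.1.5)] -/
theorem integral_eq_integral_sub_add_control {f g : ℝ → ℝ} {J : ℝ}
    (hf : IntervalIntegrable f volume 0 1) (hg : IntervalIntegrable g volume 0 1)
    (hJ : ∫ x in (0:ℝ)..1, g x = J) :
    ∫ x in (0:ℝ)..1, f x = (∫ x in (0:ℝ)..1, (f x - g x)) + J := by
  rw [intervalIntegral.integral_sub hf hg, hJ]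
  ring

/-- (5.9.1.4): if `|f - g| ≤ ε` on `[0, 1]` (5.9.1.1) then the variance of the modified problem
satisfies `σ₁² = ∫ (f-g)² - (∫ (f-g))² ≤ ε²`, i.e. `σ₁ ≤ ε`.
[cite: DavisRabinowitz1984, Sect. 5.9.1 (5.9.1.1), (5.9.1.4)] -/
theorem mcVariance_sub_le_sq {f g : ℝ → ℝ} {ε : ℝ}
    (hfg2 : IntervalIntegrable (fun x => (f x - g x) ^ 2) volume 0 1)
    (h : ∀ x ∈ Set.Icc (0:ℝ) 1, |f x - g x| ≤ ε) :
    mcVariance (fun x => f x - g x) ≤ ε ^ 2 := by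
  have hε : 0 ≤ ε := (abs_nonneg _).trans (h 0 ⟨le_rfl, zero_le_one⟩)
  unfold mcVariance
  have h1 : ∫ x in (0:ℝ)..1, (f x - g x) ^ 2 ≤ ε ^ 2 := by
    have := intervalIntegral.integral_mono_on zero_le_one hfg2 intervalIntegrable_const
      (fun x hx => show (f x - g x) ^ 2 ≤ ε ^ 2 from by
        rw [← sq_abs]; exact pow_le_pow_left₀ (abs_nonneg _) (h x hx) 2)
    simpa using this
  nlinarith [sq_nonneg (∫ x in (0:ℝ)..1, (f x - g x))]

/-- Hence the standard deviation bound `σ₁ ≤ ε` of the text.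
[cite: DavisRabinowitz1984, Sect. 5.9.1 (5.9.1.4)] -/
theorem sqrt_mcVariance_sub_le {f g : ℝ → ℝ} {ε : ℝ}
    (hfg2 : IntervalIntegrable (fun x => (f x - g x) ^ 2) volume 0 1)
    (h : ∀ x ∈ Set.Icc (0:ℝ) 1, |f x - g x| ≤ ε) :
    Real.sqrt (mcVariance (fun x => f x - g x)) ≤ ε := by
  have hε : 0 ≤ ε := (abs_nonneg _).trans (h 0 ⟨le_rfl, zero_le_one⟩)
  rw [← Real.sqrt_sq hε]
  exact Real.sqrt_le_sqrt (mcVariance_sub_le_sq hfg2 h)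

/-- (5.9.1.6): the relative effectiveness of a variance reduction — two methods with standard
deviations `σ₁, σ₂` and times proportional to `N₁, N₂` compare as `N₁^{1/2} σ₁ / (N₂^{1/2} σ₂)`.
[cite: DavisRabinowitz1984, Sect. 5.9.1 (5.9.1.6)] -/
noncomputable def relativeEffectiveness (σ₁ σ₂ N₁ N₂ : ℝ) : ℝ :=
  Real.sqrt N₁ * σ₁ / (Real.sqrt N₂ * σ₂)

/-- (5.9.1.6) as displayed: `(λ σ₁/(n^{1/2} (N₂/N₁)^{1/2})) / (λ σ₂/n^{1/2}) = N₁^{1/2} σ₁/(N₂^{1/2} σ₂)`.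
[cite: DavisRabinowitz1984, Sect. 5.9.1 (5.9.1.6)] -/
theorem relativeEffectiveness_eq {σ₁ σ₂ N₁ N₂ n lam : ℝ} (hN₁ : 0 < N₁) (hN₂ : 0 < N₂)
    (hn : 0 < n) (hlam : lam ≠ 0) (hσ₂ : σ₂ ≠ 0) :
    (lam * σ₁ / (Real.sqrt n * Real.sqrt (N₂ / N₁))) / (lam * σ₂ / Real.sqrt n) =
      relativeEffectiveness σ₁ σ₂ N₁ N₂ := by
  unfold relativeEffectiveness
  have h1 : Real.sqrt n ≠ 0 := (Real.sqrt_pos.mpr hn).ne'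
  have h2 : Real.sqrt N₁ ≠ 0 := (Real.sqrt_pos.mpr hN₁).ne'
  have h3 : Real.sqrt N₂ ≠ 0 := (Real.sqrt_pos.mpr hN₂).ne'
  rw [Real.sqrt_div' _ hN₁.le]
  field_simp

/-- The text's example: the variance of `eˣ` on `[0, 1]` is `½(e² - 1) - (e - 1)²`.
[cite: DavisRabinowitz1984, Sect. 5.9.1 (5.9.1.6)] -/
theorem mcVariance_exp : mcVariance Real.exp = (Real.exp 2 - 1) / 2 - (Real.exp 1 - 1) ^ 2 := by
  unfold mcVariance
  have h2 : ∫ x in (0:ℝ)..1, Real.exp x ^ 2 = (Real.exp 2 - 1) / 2 := by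
    have : ∀ x : ℝ, Real.exp x ^ 2 = Real.exp (2 * x) := fun x => by
      rw [← Real.exp_nat_mul]; norm_num
    simp_rw [this]
    rw [intervalIntegral.integral_comp_mul_left (fun x => Real.exp x) (by norm_num : (2:ℝ) ≠ 0),
      integral_exp, smul_eq_mul, mul_one, mul_zero, Real.exp_zero]
    ring
  rw [h2, integral_exp, Real.exp_zero]

/-- `= .242`: `.2420 < ½(e² - 1) - (e - 1)² < .2421`. [cite: DavisRabinowitz1984, Sect. 5.9.1 (5.9.1.6)] -/
theorem mcVariance_exp_bounds : 0.2420 < mcVariance Real.exp ∧ mcVariance Real.exp < 0.2421 := by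
  rw [mcVariance_exp, show Real.exp 2 = Real.exp 1 ^ 2 by rw [← Real.exp_nat_mul]; norm_num]
  have h1 := Real.exp_one_gt_d9
  have h2 := Real.exp_one_lt_d9
  constructor <;> nlinarith

/-- The variance of the modified integrand `eˣ - 1 - x` (control variate `g = 1 + x`, `J = 3/2`) is
`½(e - 1)(5 - e) - 23/12`. [cite: DavisRabinowitz1984, Sect. 5.9.1 (5.9.1.4)] -/
theorem mcVariance_exp_sub_linear :
    mcVariance (fun x => Real.exp x - 1 - x) = (Real.exp 1 - 1) * (5 - Real.exp 1) / 2 - 23 / 12 := by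
  unfold mcVariance
  have hsq : ∀ x : ℝ, (Real.exp x - 1 - x) ^ 2 =
      Real.exp (2 * x) - 2 * Real.exp x - 2 * (x * Real.exp x) + (1 + 2 * x + x ^ 2) := fun x => by
    rw [show Real.exp (2 * x) = Real.exp x ^ 2 by rw [← Real.exp_nat_mul]; norm_num]; ring
  have hxe : ∫ x in (0:ℝ)..1, x * Real.exp x = 1 := by
    have := integral_mul_deriv_eq_deriv_mul (a := (0:ℝ)) (b := 1) (u := fun x => x)
      (v := Real.exp) (u' := fun _ => 1) (v' := Real.exp)
      (fun x _ => hasDerivAt_id x) (fun x _ => Real.hasDerivAt_exp x)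
      intervalIntegrable_const (Real.continuous_exp.intervalIntegrable _ _)
    simp only [one_mul, integral_exp] at this
    rw [this]; norm_num
  have he2 : ∫ x in (0:ℝ)..1, Real.exp (2 * x) = (Real.exp 2 - 1) / 2 := by
    rw [intervalIntegral.integral_comp_mul_left (fun x => Real.exp x) (by norm_num : (2:ℝ) ≠ 0),
      integral_exp, smul_eq_mul, mul_one, mul_zero, Real.exp_zero]
    ring
  have hi1 : IntervalIntegrable (fun x => Real.exp (2 * x)) volume (0:ℝ) 1 := by
    apply Continuous.intervalIntegrable; fun_prop
  have hi2 : IntervalIntegrable (fun x => 2 * Real.exp x) volume (0:ℝ) 1 := by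
    apply Continuous.intervalIntegrable; fun_prop
  have hi3 : IntervalIntegrable (fun x => 2 * (x * Real.exp x)) volume (0:ℝ) 1 := by
    apply Continuous.intervalIntegrable; fun_prop
  have hi4 : IntervalIntegrable (fun x : ℝ => 1 + 2 * x + x ^ 2) volume (0:ℝ) 1 := by
    apply Continuous.intervalIntegrable; fun_prop
  simp_rw [hsq]
  rw [intervalIntegral.integral_add ((hi1.sub hi2).sub hi3) hi4,
    intervalIntegral.integral_sub (hi1.sub hi2) hi3, intervalIntegral.integral_sub hi1 hi2,
    intervalIntegral.integral_const_mul, intervalIntegral.integral_const_mul, he2, hxe, integral_exp]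
  have hlin : ∫ x in (0:ℝ)..1, Real.exp x - 1 - x = Real.exp 1 - 1 - 3 / 2 := by
    rw [intervalIntegral.integral_sub ((Real.continuous_exp.intervalIntegrable _ _).sub
      intervalIntegrable_const) intervalIntegrable_id,
      intervalIntegral.integral_sub (Real.continuous_exp.intervalIntegrable _ _) intervalIntegrable_const,
      integral_exp, intervalIntegral.integral_const, integral_id, smul_eq_mul, Real.exp_zero]
    ring
  have hpoly : ∫ x in (0:ℝ)..1, (1 + 2 * x + x ^ 2) = 7 / 3 := by
    rw [intervalIntegral.integral_add (by apply Continuous.intervalIntegrable; fun_prop)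
      (by apply Continuous.intervalIntegrable; fun_prop),
      intervalIntegral.integral_add intervalIntegrable_const (by apply Continuous.intervalIntegrable; fun_prop),
      intervalIntegral.integral_const_mul, integral_id, integral_pow, intervalIntegral.integral_const]
    norm_num
  rw [hlin, hpoly, Real.exp_zero, show Real.exp 2 = Real.exp 1 ^ 2 by rw [← Real.exp_nat_mul]; norm_num]
  ring

/-- `= .044`: `.0436 < ½(e - 1)(5 - e) - 23/12 < .0437` (a variance reduction by the factor `≈ 5.5`).
[cite: DavisRabinowitz1984, Sect. 5.9.1 (5.9.1.4)] -/
theorem mcVariance_exp_sub_linear_bounds :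
    0.0436 < mcVariance (fun x => Real.exp x - 1 - x) ∧ mcVariance (fun x => Real.exp x - 1 - x) < 0.0437 := by
  rw [mcVariance_exp_sub_linear]
  have h1 := Real.exp_one_gt_d9
  have h2 := Real.exp_one_lt_d9
  constructor <;> nlinarith

/-! ## Importance sampling (5.9.1.7)-(5.9.1.12) -/

/-- (5.9.1.7): `I = ∫_0^1 f = ∫_0^1 (f/p) p` for a density `p` that does not vanish on `[0, 1]`.
[cite: DavisRabinowitz1984, Sect. 5.9.1 (5.9.1.7)] -/
theorem integral_div_mul_density {f p : ℝ → ℝ} (hp : ∀ x ∈ Set.Icc (0:ℝ) 1, p x ≠ 0) :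
    ∫ x in (0:ℝ)..1, f x / p x * p x = ∫ x in (0:ℝ)..1, f x := by
  refine intervalIntegral.integral_congr fun x hx => ?_
  rw [Set.uIcc_of_le zero_le_one] at hx
  exact div_mul_cancel₀ (f x) (hp x hx)

/-- (5.9.1.10): the variance of the importance-sampling estimator (5.9.1.9),
`σ² = ∫_0^1 (f²/p²) p - (∫_0^1 (f/p) p)²`. [cite: DavisRabinowitz1984, Sect. 5.9.1 (5.9.1.10)] -/
noncomputable def importanceVariance (f p : ℝ → ℝ) : ℝ :=
  (∫ x in (0:ℝ)..1, f x ^ 2 / p x ^ 2 * p x) - (∫ x in (0:ℝ)..1, f x / p x * p x) ^ 2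

/-- (5.9.1.10) simplified: `σ² = ∫_0^1 f²/p - I²`. [cite: DavisRabinowitz1984, Sect. 5.9.1 (5.9.1.10)] -/
theorem importanceVariance_eq {f p : ℝ → ℝ} (hp : ∀ x ∈ Set.Icc (0:ℝ) 1, p x ≠ 0) :
    importanceVariance f p = (∫ x in (0:ℝ)..1, f x ^ 2 / p x) - (∫ x in (0:ℝ)..1, f x) ^ 2 := by
  unfold importanceVariance
  rw [integral_div_mul_density hp]
  congr 1
  refine intervalIntegral.integral_congr fun x hx => ?_
  rw [Set.uIcc_of_le zero_le_one] at hx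
  have := hp x hx
  field_simp

/-- With the uniform density `p ≡ 1` importance sampling is crude Monte Carlo: `σ² = σ²(f)`.
[cite: DavisRabinowitz1984, Sect. 5.9.1 (5.9.1.10)] -/
theorem importanceVariance_one (f : ℝ → ℝ) : importanceVariance f (fun _ => 1) = mcVariance f := by
  simp [importanceVariance, mcVariance]

/-- (5.9.1.11)-(5.9.1.12): sampling in proportion to the integrand, `p = f / I` with `I = ∫_0^1 f ≠ 0`
(and `f` non-vanishing on `[0, 1]`, e.g. `f > 0`), gives ZERO variance — "but we should then need to
know the solution to our problem beforehand". [cite: DavisRabinowitz1984, Sect. 5.9.1 (5.9.1.11)-(5.9.1.12)] -/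
theorem importanceVariance_eq_zero_of_proportional {f p : ℝ → ℝ} (hI : (∫ x in (0:ℝ)..1, f x) ≠ 0)
    (hf : ∀ x ∈ Set.Icc (0:ℝ) 1, f x ≠ 0)
    (hp : ∀ x ∈ Set.Icc (0:ℝ) 1, p x = f x / ∫ t in (0:ℝ)..1, f t) :
    importanceVariance f p = 0 := by
  set I := ∫ t in (0:ℝ)..1, f t with hIdef
  have hp0 : ∀ x ∈ Set.Icc (0:ℝ) 1, p x ≠ 0 := fun x hx => by
    rw [hp x hx]; exact div_ne_zero (hf x hx) hI
  rw [importanceVariance_eq hp0]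
  have h : ∫ x in (0:ℝ)..1, f x ^ 2 / p x = ∫ x in (0:ℝ)..1, I * f x := by
    refine intervalIntegral.integral_congr fun x hx => ?_
    rw [Set.uIcc_of_le zero_le_one] at hx
    rw [hp x hx]
    have := hf x hx
    field_simp
  rw [h, intervalIntegral.integral_const_mul, ← hIdef]
  ring

/-- The text's example: `p(x) = ⅔(1 + x)` is a density on `[0, 1]` (5.9.1.8): `∫_0^1 ⅔(1 + x) dx = 1`.
[cite: DavisRabinowitz1984, Sect. 5.9.1 (5.9.1.8)] -/
theorem integral_example_density : ∫ x in (0:ℝ)..1, 2 / 3 * (1 + x) = 1 := by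
  rw [intervalIntegral.integral_const_mul,
    intervalIntegral.integral_add intervalIntegrable_const intervalIntegrable_id,
    intervalIntegral.integral_const, integral_id]
  norm_num

/-- … it is positive on `[0, 1]`, and the importance-sampling summand for `f = eˣ` is
`f/p = (3/2) eˣ/(1 + x)` (the estimator `(3/2n) Σ e^{x_i}/(1 + x_i)` of the text).
[cite: DavisRabinowitz1984, Sect. 5.9.1 (5.9.1.9)] -/
theorem example_importance_summand (x : ℝ) (hx : x ∈ Set.Icc (0:ℝ) 1) :
    0 < 2 / 3 * (1 + x) ∧ Real.exp x / (2 / 3 * (1 + x)) = 3 / 2 * (Real.exp x / (1 + x)) := by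
  have h1 : 0 < 1 + x := by linarith [hx.1]
  refine ⟨by positivity, ?_⟩
  field_simp

/-- For this example (5.9.1.7) reads `∫_0^1 (3/2) eˣ/(1+x) · ⅔(1+x) dx = ∫_0^1 eˣ dx = e - 1`.
[cite: DavisRabinowitz1984, Sect. 5.9.1 (5.9.1.7)] -/
theorem example_importance_unbiased :
    ∫ x in (0:ℝ)..1, Real.exp x / (2 / 3 * (1 + x)) * (2 / 3 * (1 + x)) = Real.exp 1 - 1 := by
  rw [integral_div_mul_density (fun x hx => by have := hx.1; positivity)]
  simp

end Literature.Analysis.Quadrature
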